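import Summits.ABC.IUTFork.Joshi.ArithTeichmullerScaling
import HarnessLib

/-!
# A CONTENTFUL points-signature on which Joshi's action DILATES: copies of `ℂ_p` with the norm rescaled
# (the relation between a Fargues–Fontaine point and its Frobenius translate), permuted by `Aut(𝔽₂²)`

Witness (model) file of the abc-iut cell, branch E (seat abc-iut-E-t1, [J-I] carrier owner; rung LADDER-ABC:A2.E). TAKES NO SIDE
on [IUTchIII] Cor. 3.12 or on any author; typed ≠ proved ≠ endorsed; this is a MODEL of the signature `UntiltPoints`
(ArithTeichmullerAction p429850), labelled honestly: it realises the DILATATION half of Joshi's picture ([J-I] v4 Thm 5.4.1 /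
Cor 5.4.2 «the p-adic metrics … are scaled relative to …»; 2021 §10 (pa:norm-example) `K₂ = W(𝒪_{ℂ_p♭})[1/p]/([t^r] − p)` «norms …
differing by a dilatation by factor r»; the Frobenius translate `y = ([a] − p) ↦ φ(y) = ([a^p] − p)` has `|p|_{K_{φ(y)}} = |p|^p_{K_y}`,
[FarguesFontaine2018] Prop. 2.2.17) — NOT the Kedlaya–Temkin half (`ExistsNonIsomorphic`): the residue fields below are pairwise
TOPOLOGICALLY ISOMORPHIC (`rescaled_topIso`). Nothing here is a claim of Joshi's; everything is PROVED over Mathlib. [folklore]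

CONSTRUCTION. §1 `Rescaled p c` / `Untilt.rescaled p c hc` (`0 < c`): the field `ℂ_[p]` with the norm `‖x‖^c` — a `NormedField`
structure built by hand on a type synonym with THE SAME uniform structure as `ℂ_[p]` (`uniformity_dist` re-proved from
`{‖x−y‖^c < ε} = {‖x−y‖ < ε^{1/c}}`), so completeness is inherited; ultrametric, algebraically closed, characteristic `0`,
`‖p‖ = p^{−c} < 1`. §2 `threePoint p c`: the points-signature with `𝒪_E := 𝔽₂`, `𝒢 := 𝔽₂ × 𝔽₂` (discrete), `|𝒴| := (𝒢 − {0})/𝔽₂^×`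
(the three nonzero vectors), residue field `ℂ_p^{(1)}` at the class `e₁` of `(1,0)` and `ℂ_p^{(c)}` elsewhere, preferred algebraic
closures = the completion map `Q̄_p → ℂ_[p]`, Frobenius the identity. §3 RESULTS: `exponent_threePoint` (the scaling exponent of
p431060 IS `1` at `e₁` and `c` elsewhere); the swap `σ ∈ Aut(𝔽₂²)` (continuous, discrete topology) moves `e₁` to `e₂`; hence
**`threePoint_actionDilates : (threePoint p c hc).ActionDilates`** for `c ≠ 1` — Joshi's claim-Prop `ActionDilates` (the premise of
`DictionaryUntiltsVolume.not_movesAreInd_and_datumEquivariant`) is SATISFIABLE on a signature whose moves are genuine continuous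
automorphisms; `rescaled_topIso` (dilatation WITHOUT change of topology, consistent with `FrobPreservesUntilt`).
-/

noncomputable section

open Filter Topology

namespace Summit.ABC.IUTFork.Joshi

/-! ## 1. `ℂ_p` with the norm `‖·‖^c` -/

/-- Type synonym: `ℂ_[p]` to be equipped with the rescaled norm `‖x‖^c`. [folklore] -/
def Rescaled (p : ℕ) [Fact p.Prime] (_c : ℝ) : Type := ℂ_[p]

namespace Rescaled

variable (p : ℕ) [Fact p.Prime] (c : ℝ)

/-- The identity `ℂ_[p] → Rescaled p c`. [folklore] -/
def of : ℂ_[p] → Rescaled p c := id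
/-- The identity `Rescaled p c → ℂ_[p]`. [folklore] -/
def val : Rescaled p c → ℂ_[p] := id

/-- The field structure (that of `ℂ_[p]`). [folklore] -/
@[reducible] def instField : Field (Rescaled p c) := inferInstanceAs (Field ℂ_[p])

/-- The sets `{‖−x + y‖^c < ε}` and `{dist x y < ε^{1/c}}` of `ℂ_[p] × ℂ_[p]` coincide (`c > 0`). [folklore] -/
theorem setOf_rpow_lt {c : ℝ} (hc : 0 < c) (ε : ℝ) (hε : 0 < ε) :
    {q : ℂ_[p] × ℂ_[p] | ‖-q.1 + q.2‖ ^ c < ε} = {q : ℂ_[p] × ℂ_[p] | dist q.1 q.2 < ε ^ c⁻¹} := by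
  ext q
  simp only [Set.mem_setOf_eq, dist_eq_norm]
  rw [← neg_sub, norm_neg, ← Real.rpow_lt_rpow_iff (norm_nonneg _) (Real.rpow_nonneg hε.le _) hc,
    Real.rpow_inv_rpow hε.le hc.ne', neg_add_eq_sub]

/-- **`ℂ_[p]` with the norm `‖x‖^c` is a normed field with the SAME uniform structure** (ultrametricity makes `‖·‖^c` subadditive
for every `c > 0`). [folklore] -/
@[reducible] def instNormedField {c : ℝ} (hc : 0 < c) : NormedField (Rescaled p c) :=
  { instField p c with
    norm := fun x => ‖val p c x‖ ^ c
    dist := fun x y => ‖-(val p c x) + val p c y‖ ^ c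
    dist_self := fun x => by
      show ‖-(val p c x) + val p c x‖ ^ c = 0
      rw [neg_add_cancel, norm_zero, Real.zero_rpow hc.ne']
    dist_comm := fun x y => by
      show ‖-(val p c x) + val p c y‖ ^ c = ‖-(val p c y) + val p c x‖ ^ c
      rw [← norm_neg, neg_add, neg_neg, add_comm]
    dist_triangle := fun x y z => by
      show ‖-(val p c x) + val p c z‖ ^ c ≤ ‖-(val p c x) + val p c y‖ ^ c + ‖-(val p c y) + val p c z‖ ^ c
      have hsum : -(val p c x) + val p c z = (-(val p c x) + val p c y) + (-(val p c y) + val p c z) := by abel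
      have hultra : ‖-(val p c x) + val p c z‖ ≤ max ‖-(val p c x) + val p c y‖ ‖-(val p c y) + val p c z‖ := by
        rw [hsum]; exact IsUltrametricDist.norm_add_le_max _ _
      calc ‖-(val p c x) + val p c z‖ ^ c ≤ (max ‖-(val p c x) + val p c y‖ ‖-(val p c y) + val p c z‖) ^ c :=
            Real.rpow_le_rpow (norm_nonneg _) hultra hc.le
        _ ≤ ‖-(val p c x) + val p c y‖ ^ c + ‖-(val p c y) + val p c z‖ ^ c := by
            rcases le_total ‖-(val p c x) + val p c y‖ ‖-(val p c y) + val p c z‖ with h | h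
            · rw [max_eq_right h]; exact le_add_of_nonneg_left (Real.rpow_nonneg (norm_nonneg _) _)
            · rw [max_eq_left h]; exact le_add_of_nonneg_right (Real.rpow_nonneg (norm_nonneg _) _)
    eq_of_dist_eq_zero := fun {x y} h => by
      change ‖-(val p c x) + val p c y‖ ^ c = 0 at h
      rw [Real.rpow_eq_zero_iff_of_nonneg (norm_nonneg _), norm_eq_zero, neg_add_eq_zero] at h
      exact h.1
    dist_eq := fun x y => rfl
    norm_mul := fun a b => by
      show ‖val p c a * val p c b‖ ^ c = ‖val p c a‖ ^ c * ‖val p c b‖ ^ c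
      rw [norm_mul, Real.mul_rpow (norm_nonneg _) (norm_nonneg _)]
    toUniformSpace := inferInstanceAs (UniformSpace ℂ_[p])
    uniformity_dist := by
      show uniformity ℂ_[p] = ⨅ ε > (0 : ℝ), 𝓟 {q : ℂ_[p] × ℂ_[p] | ‖-q.1 + q.2‖ ^ c < ε}
      rw [PseudoMetricSpace.uniformity_dist]
      refine le_antisymm ?_ ?_
      · refine le_iInf₂ fun ε hε => ?_
        rw [setOf_rpow_lt p hc ε hε]
        exact iInf₂_le (ε ^ c⁻¹) (Real.rpow_pos_of_pos hε _)
      · refine le_iInf₂ fun ε hε => ?_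
        have h := setOf_rpow_lt p hc (ε ^ c) (Real.rpow_pos_of_pos hε c)
        rw [Real.rpow_rpow_inv hε.le hc.ne'] at h
        rw [← h]
        exact iInf₂_le (ε ^ c) (Real.rpow_pos_of_pos hε c) }

/-- Completeness is INHERITED (same uniform structure as `ℂ_[p]`). [folklore] -/
theorem instCompleteSpace {c : ℝ} (hc : 0 < c) :
    @CompleteSpace (Rescaled p c) (instNormedField p hc).toUniformSpace :=
  inferInstanceAs (CompleteSpace ℂ_[p])

/-- The rescaled distance is ultrametric. [folklore] -/
theorem instIsUltrametricDist {c : ℝ} (hc : 0 < c) :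
    @IsUltrametricDist (Rescaled p c) (instNormedField p hc).toDist := by
  refine @IsUltrametricDist.mk _ (instNormedField p hc).toDist fun x y z => ?_
  show ‖-(val p c x) + val p c z‖ ^ c ≤ max (‖-(val p c x) + val p c y‖ ^ c) (‖-(val p c y) + val p c z‖ ^ c)
  have hsum : -(val p c x) + val p c z = (-(val p c x) + val p c y) + (-(val p c y) + val p c z) := by abel
  have hultra : ‖-(val p c x) + val p c z‖ ≤ max ‖-(val p c x) + val p c y‖ ‖-(val p c y) + val p c z‖ := by
    rw [hsum]; exact IsUltrametricDist.norm_add_le_max _ _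
  rcases le_total ‖-(val p c x) + val p c y‖ ‖-(val p c y) + val p c z‖ with h | h
  · rw [max_eq_right h] at hultra
    exact le_max_of_le_right (Real.rpow_le_rpow (norm_nonneg _) hultra hc.le)
  · rw [max_eq_left h] at hultra
    exact le_max_of_le_left (Real.rpow_le_rpow (norm_nonneg _) hultra hc.le)

/-- Algebraically closed (it is the field `ℂ_[p]`). [folklore] -/
theorem instIsAlgClosed : @IsAlgClosed (Rescaled p c) (instField p c) := inferInstanceAs (IsAlgClosed ℂ_[p])

/-- Characteristic zero. [folklore] -/
theorem instCharZero {c : ℝ} (hc : 0 < c) :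
    @CharZero (Rescaled p c) (instNormedField p hc).toNormedCommRing.toSeminormedCommRing.toSeminormedRing.toRing.toAddGroupWithOne.toAddMonoidWithOne :=
  inferInstanceAs (CharZero ℂ_[p])

/-- `‖p‖^c < 1`. [folklore] -/
theorem norm_p_lt_one {c : ℝ} (hc : 0 < c) :
    @norm (Rescaled p c) (instNormedField p hc).toNorm (@Nat.cast (Rescaled p c) (instField p c).toDivisionRing.toRing.toAddGroupWithOne.toNatCast p) < 1 := by
  show ‖(p : ℂ_[p])‖ ^ c < 1
  exact Real.rpow_lt_one (norm_nonneg _) (Untilt.padicComplex p).norm_p_lt_one hc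

end Rescaled

variable (p : ℕ) [Fact p.Prime]

/-- **The rescaled untilt `ℂ_p^{(c)}`**: the algebraically closed perfectoid field `ℂ_p` with absolute value `‖·‖^c` (`c > 0`), as an
inhabitant of `Untilt p`. [folklore] -/
def Untilt.rescaled (c : ℝ) (hc : 0 < c) : Untilt p :=
  @Untilt.mk p _ (Rescaled p c) (Rescaled.instNormedField p hc) (Rescaled.instCompleteSpace p hc)
    (Rescaled.instIsUltrametricDist p hc) (Rescaled.instIsAlgClosed p c) (Rescaled.instCharZero p hc)
    (Rescaled.norm_p_lt_one p hc)

/-- The identity `ℂ_p^{(c)} ≅ ℂ_p^{(c′)}` as a ring isomorphism. [folklore] -/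
def rescaledEquiv (c c' : ℝ) (hc : 0 < c) (hc' : 0 < c') : (Untilt.rescaled p c hc).K ≃+* (Untilt.rescaled p c' hc').K where
  toFun := fun x => Rescaled.of p c' (Rescaled.val p c x)
  invFun := fun x => Rescaled.of p c (Rescaled.val p c' x)
  left_inv := fun _ => rfl
  right_inv := fun _ => rfl
  map_mul' := fun _ _ => rfl
  map_add' := fun _ _ => rfl

/-- Two rescaled untilts are TOPOLOGICALLY ISOMORPHIC (same field, same topology: the identity) — dilatation without change of
topology, the situation of a Fargues–Fontaine point and its Frobenius translate. [folklore] -/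
theorem rescaled_topIso (c c' : ℝ) (hc : 0 < c) (hc' : 0 < c') :
    (Untilt.rescaled p c hc).TopIso (Untilt.rescaled p c' hc') :=
  ⟨⟨rescaledEquiv p c c' hc hc', continuous_def.2 fun _ hs => hs, continuous_def.2 fun _ hs => hs⟩⟩

/-! ## 2. The three-point signature -/

/-- The embedding `Q̄_p ↪ ℂ_p^{(c)}` (Mathlib's completion map; the target is the field `ℂ_[p]`). [folklore] -/
def algClRescaled (c : ℝ) (hc : 0 < c) : AlgebraicClosure ℚ_[p] →+* (Untilt.rescaled p c hc).K where
  toFun x := Rescaled.of p c ((UniformSpace.Completion.coeRingHom : PadicAlgCl p →+* ℂ_[p]) x)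
  map_one' := map_one (UniformSpace.Completion.coeRingHom : PadicAlgCl p →+* ℂ_[p])
  map_mul' x y := map_mul (UniformSpace.Completion.coeRingHom : PadicAlgCl p →+* ℂ_[p]) x y
  map_zero' := map_zero (UniformSpace.Completion.coeRingHom : PadicAlgCl p →+* ℂ_[p])
  map_add' x y := map_add (UniformSpace.Completion.coeRingHom : PadicAlgCl p →+* ℂ_[p]) x y

/-- Unfolding: the embedding followed by `val` is the completion map. [folklore] -/
theorem val_algClRescaled (c : ℝ) (hc : 0 < c) (x : AlgebraicClosure ℚ_[p]) :
    Rescaled.val p c (algClRescaled p c hc x) = ((x : PadicAlgCl p) : ℂ_[p]) := rfl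

/-- … continuous on `ℚ_p` (same topology as `ℂ_[p]`). [folklore] -/
theorem continuous_algClRescaled (c : ℝ) (hc : 0 < c) :
    Continuous fun x : ℚ_[p] => algClRescaled p c hc (algebraMap ℚ_[p] (AlgebraicClosure ℚ_[p]) x) :=
  (UniformSpace.Completion.continuous_coe (PadicAlgCl p)).comp (continuous_algebraMap ℚ_[p] (PadicAlgCl p))

/-- The norm of the embedded `x ∈ Q̄_p` in `ℂ_p^{(c)}` is `‖x‖^c`. [folklore] -/
theorem norm_algClRescaled (c : ℝ) (hc : 0 < c) (x : AlgebraicClosure ℚ_[p]) :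
    ‖algClRescaled p c hc x‖ = ‖(x : PadicAlgCl p)‖ ^ c := by
  show ‖((x : PadicAlgCl p) : ℂ_[p])‖ ^ c = _
  rw [PadicComplex.norm_extends]

/-- The class of the basis vector `e₁ = (1,0)` of `𝔽₂²` in `(𝔽₂² − {0})/𝔽₂^×`. [folklore] -/
def e1 : ProjPoints (ZMod 2) (ZMod 2 × ZMod 2) :=
  Quotient.mk (unitRel (ZMod 2) (ZMod 2 × ZMod 2)) ⟨(1, 0), by simp⟩

/-- The class of `e₂ = (0,1)`. [folklore] -/
def e2 : ProjPoints (ZMod 2) (ZMod 2 × ZMod 2) :=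
  Quotient.mk (unitRel (ZMod 2) (ZMod 2 × ZMod 2)) ⟨(0, 1), by simp⟩

/-- `e₁ ≠ e₂` in `(𝔽₂² − {0})/𝔽₂^×` (the only unit of `𝔽₂` is `1`). [folklore] -/
theorem e1_ne_e2 : e1 ≠ e2 := by
  intro h
  obtain ⟨u, hu⟩ := Quotient.exact h
  have hu1 : u = 1 := Subsingleton.elim u 1
  rw [hu1, one_smul] at hu
  exact absurd (congrArg Prod.fst hu) (by decide)

open Classical in
/-- The exponent profile of the three-point signature: `1` at `e₁`, `c` elsewhere. [folklore] -/
def expo (c : ℝ) (y : ProjPoints (ZMod 2) (ZMod 2 × ZMod 2)) : ℝ := if y = e1 then 1 else c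

/-- The exponent profile is positive. [folklore] -/
theorem expo_pos {c : ℝ} (hc : 0 < c) (y : ProjPoints (ZMod 2) (ZMod 2 × ZMod 2)) : 0 < expo c y := by
  unfold expo; split_ifs
  · exact one_pos
  · exact hc

/-- **The THREE-POINT signature** `threePoint p c hc`: `𝒪_E := 𝔽₂`, `𝒢 := 𝔽₂²` (discrete), `|𝒴| := (𝒢 − {0})/𝔽₂^×`, residue field
`ℂ_p^{(expo y)}` (`ℂ_p` itself, up to the identity, at `e₁`; the `c`-rescaled `ℂ_p` elsewhere), Frobenius the identity, preferred
algebraic closures the completion map. A MODEL of `UntiltPoints` (no claim of Joshi's used or asserted). [folklore] -/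
def threePoint (c : ℝ) (hc : 0 < c) : UntiltPoints p (ZMod 2) where
  Pt := ProjPoints (ZMod 2) (ZMod 2 × ZMod 2)
  untilt y := Untilt.rescaled p (expo c y) (expo_pos hc y)
  frob := Equiv.refl _
  algCl y := algClRescaled p (expo c y) (expo_pos hc y)
  continuous_algCl y := continuous_algClRescaled p (expo c y) (expo_pos hc y)
  G := ZMod 2 × ZMod 2
  topologicalSpace := ⊥
  ptEquiv := Equiv.refl _

/-! ## 3. The exponents, the swap, and `ActionDilates` -/

/-- **The scaling exponent of p431060 at a point of the three-point signature IS the profile `expo`** (`‖p‖_{K_y} = (p⁻¹)^{expo y}`).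
[folklore] -/
theorem exponent_threePoint (c : ℝ) (hc : 0 < c) (y : (threePoint p c hc).Pt) :
    (threePoint p c hc).exponent y = expo c y := by
  have hp1 : 1 < (p : ℝ) := by exact_mod_cast (Fact.out : p.Prime).one_lt
  have h0 : 0 < ((p : ℝ))⁻¹ := inv_pos.2 (by linarith)
  have h1 : ((p : ℝ))⁻¹ ≠ 1 := (inv_lt_one_of_one_lt₀ hp1).ne
  have hlog : Real.log ((p : ℝ)⁻¹) ≠ 0 := Real.log_ne_zero_of_pos_of_ne_one h0 h1
  unfold UntiltPoints.exponent UntiltPoints.normQp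
  show Real.log ‖algClRescaled p (expo c y) (expo_pos hc y) (algebraMap ℚ_[p] (AlgebraicClosure ℚ_[p]) p)‖ /
      Real.log ((p : ℝ)⁻¹) = expo c y
  rw [norm_algClRescaled, show (algebraMap ℚ_[p] (AlgebraicClosure ℚ_[p]) (p : ℚ_[p]) : PadicAlgCl p) = (p : PadicAlgCl p)
    from map_natCast _ p, ← map_natCast (algebraMap ℚ_[p] (PadicAlgCl p)) p, PadicAlgCl.norm_extends, Padic.norm_p,
    Real.log_rpow h0, mul_div_assoc, div_self hlog, mul_one]

/-- The swap `(a, b) ↦ (b, a)` of `𝔽₂²` as a CONTINUOUS linear automorphism (discrete topology) — an element of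
`Aut_{𝒪_E}(𝒢(𝒪_F))` of the model. [folklore] -/
def swapAut (c : ℝ) (hc : 0 < c) : (threePoint p c hc).Aut :=
  { LinearEquiv.prodComm (ZMod 2) (ZMod 2) (ZMod 2) with
    continuous_toFun := continuous_bot
    continuous_invFun := continuous_bot }

/-- The swap moves `e₁` to `e₂`. [folklore] -/
theorem ptAct_swap_e1 (c : ℝ) (hc : 0 < c) : (threePoint p c hc).ptAct (swapAut p c hc) e1 = e2 := rfl

/-- **`ActionDilates` HOLDS on the three-point signature** (`c ≠ 1`): the swap carries the holomorphic structure `e₁` (exponent `1`)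
to `e₂` (exponent `c`). So Joshi's claim-Prop `UntiltPoints.ActionDilates` — the premise of the E1-side location
`DictionaryUntiltsVolume.not_movesAreInd_and_datumEquivariant` — is SATISFIABLE on a contentful signature (genuine continuous moves,
genuinely different absolute values on `Q̄_p`). [folklore] -/
theorem threePoint_actionDilates (c : ℝ) (hc : 0 < c) (hc1 : c ≠ 1) : (threePoint p c hc).ActionDilates := by
  rw [UntiltPoints.actionDilates_iff_exponent_ne]
  refine ⟨swapAut p c hc, e1, ?_⟩
  rw [ptAct_swap_e1, exponent_threePoint, exponent_threePoint]
  unfold expo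
  rw [if_neg e1_ne_e2.symm, if_pos rfl]
  exact hc1

/-- … with the explicit dilatation factor: `IsDilatation e₁ e₂ c`. [folklore] -/
theorem threePoint_isDilatation (c : ℝ) (hc : 0 < c) : (threePoint p c hc).IsDilatation e1 e2 c := by
  rw [UntiltPoints.isDilatation_iff_eq_div, exponent_threePoint, exponent_threePoint]
  unfold expo
  rw [if_neg e1_ne_e2.symm, if_pos rfl, div_one]

/-- The residue fields of the model are pairwise topologically isomorphic: the model realises DILATATION, not the
Kedlaya–Temkin non-isomorphism (`ExistsNonIsomorphic` is not claimed for it). [folklore] -/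
theorem threePoint_topIso (c : ℝ) (hc : 0 < c) (y y' : (threePoint p c hc).Pt) :
    ((threePoint p c hc).untilt y).TopIso ((threePoint p c hc).untilt y') :=
  rescaled_topIso p _ _ _ _

end Summit.ABC.IUTFork.Joshi

end
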